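import Mathlib.Topology.Algebra.OpenSubgroup
import Mathlib.Topology.Algebra.ClopenNhdofOne
import Mathlib.Topology.Separation.Basic
import Literature.AlgebraicGeometry.Frobenioids.ProfiniteUnits
import Literature.GroupTheory.NikolovSegal
import HarnessLib

/-!
# Frobenioids I, Def. 2.8 (i) "[uniquely determined]" beyond the abelian case, I: the bridge to strong completeness, finite groups, and the reduction to Nikolov–Segal

Mochizuki, *The geometry of Frobenioids I*, Kyushu J. Math. **62** (2008), Definition 2.8 (i), kurims p. 52
[cite: MochizukiFrdI2008, Def. 2.8(i) p.52]: a group "admits a profinite topology such that, equipped with this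
topology, it is a topologically finitely generated profinite group [uniquely determined]".  The tree records the
bracket as the named statement `TfgProfiniteTopologyUnique M` (`ProfiniteUnits.lean`: two topologically finitely
generated profinite group topologies on the group `M` coincide) and proves it for ABELIAN `M`
(`TfgProfiniteTopologyUnique.of_commGroup`, `ProfiniteUnitsProofs.lean`); for a general group it is the
Nikolov–Segal theorem.  This PROOF-ONLY companion file (no definitions, no signature change) adds:

* `TfgProfiniteTopologyUnique.of_forall_finiteIndex_isOpen` — the BRIDGE: if `M` carries ONE topologically
  finitely generated profinite group topology in which every finite-index subgroup is open ("strongly complete"),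
  then ALL such topologies on `M` coincide (every open subgroup of the other topology has finite index, hence is
  open in the strongly complete one, so the identity is continuous from the strongly complete topology — compact —
  to the other one — Hausdorff); the comparison lemmas `IsTfgProfinite.le_of_forall_finiteIndex_isOpen` /
  `IsTfgProfinite.eq_of_forall_finiteIndex_isOpen` are stated for two explicit topologies on one group;
* `TfgProfiniteTopologyUnique.of_finite` — instance family: every finite group (a Hausdorff topology on a finite
  set is discrete);
* `TfgProfiniteTopologyUnique.of_nikolovSegalStatement` — the universal closure of the named statement, CONDITIONAL
  on the tree's named fact `Literature.GroupTheory.NikolovSegalStatement` [cite: NikolovSegal2003, Thm 1.1]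
  (not proved in the tree; the closure is therefore conditional, and says exactly that).

The pro-`p` instance family (Serre's theorem) is the sequel file `ProfiniteUnitsTopologyUniqueProP.lean`.
Cell abc-iut, FACT-LIST row F-1275 (`TfgProfiniteTopologyUnique`, [FrdI] Def. 2.8 (i) p.52).
HONEST FRAMING: refereed pre-IUT group theory; nothing here bears on [IUTchIII] Cor. 3.12; typed ≠ proved for the
conditional item.
-/

namespace Literature.AlgebraicGeometry.Frobenioids

open _root_.Topology Filter

universe u

section General

variable {M : Type u} [Group M]

namespace IsTfgProfinite

section OneTopology

variable [TopologicalSpace M]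

/-- An open subgroup of a (topologically finitely generated) profinite group has finite index (compactness).
[cite: MochizukiFrdI2008, Def. 2.8(i) p.52] -/
theorem finiteIndex_of_isOpen (h : IsTfgProfinite M) (U : Subgroup M) (hU : IsOpen (U : Set M)) :
    U.FiniteIndex := by
  haveI := h.isTopologicalGroup
  haveI := h.compactSpace
  haveI : Finite (M ⧸ U) := Subgroup.quotient_finite_of_isOpen U hU
  exact Subgroup.finiteIndex_of_finite_quotient

/-- In a profinite group, every point `x` of an open set `s` has a whole coset `x·U` of some FINITE-INDEX
subgroup `U` inside `s` (namely of an open subgroup `U`). [cite: MochizukiFrdI2008, Def. 2.8(i) p.52] -/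
theorem exists_finiteIndex_mul_mem (h : IsTfgProfinite M) {s : Set M} (hs : IsOpen s) {x : M}
    (hx : x ∈ s) : ∃ U : Subgroup M, U.FiniteIndex ∧ ∀ u ∈ U, x * u ∈ s := by
  haveI := h.isTopologicalGroup
  haveI := h.compactSpace
  haveI := h.totallyDisconnectedSpace
  -- the open neighbourhood `{u | x * u ∈ s}` of `1` contains an open (normal) subgroup
  have hc : Continuous fun u : M => x * u := continuous_const.mul continuous_id
  obtain ⟨U, hU⟩ := ProfiniteGrp.exist_openNormalSubgroup_sub_open_nhds_of_one (hs.preimage hc)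
    (show x * 1 ∈ s by simpa using hx)
  exact ⟨U.toSubgroup, h.finiteIndex_of_isOpen _ U.isOpen, fun u hu => hU hu⟩

/-- If every finite-index subgroup of the topological group `M` is open, then a set all of whose points `x`
contain a coset `x·U` of a finite-index subgroup `U` is open. [cite: MochizukiFrdI2008, Def. 2.8(i) p.52] -/
theorem isOpen_of_forall_finiteIndex_mul_mem (h : IsTfgProfinite M)
    (hsc : ∀ H : Subgroup M, H.FiniteIndex → IsOpen (H : Set M)) {s : Set M}
    (hs : ∀ x ∈ s, ∃ U : Subgroup M, U.FiniteIndex ∧ ∀ u ∈ U, x * u ∈ s) : IsOpen s := by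
  haveI := h.isTopologicalGroup
  rw [isOpen_iff_forall_mem_open]
  intro x hx
  obtain ⟨U, hU, hUs⟩ := hs x hx
  refine ⟨(fun y : M => x⁻¹ * y) ⁻¹' (U : Set M), ?_, ?_, ?_⟩
  · intro y hy
    have := hUs (x⁻¹ * y) hy
    simpa [mul_inv_cancel_left] using this
  · exact (hsc U hU).preimage (continuous_const.mul continuous_id)
  · show x⁻¹ * x ∈ (U : Set M)
    simp

end OneTopology

/-- **Comparison, first half.**  If `t₀` is a topologically finitely generated profinite group topology on `M`
in which every finite-index subgroup is open, then `t₀` is FINER than every topologically finitely generated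
profinite group topology `t` on `M` (`t₀ ≤ t`): every `t`-open set is a union of cosets of `t`-open, hence
finite-index, hence `t₀`-open subgroups. [cite: MochizukiFrdI2008, Def. 2.8(i) p.52] -/
theorem le_of_forall_finiteIndex_isOpen {t₀ t : TopologicalSpace M} (h₀ : @IsTfgProfinite M _ t₀)
    (hsc : ∀ H : Subgroup M, H.FiniteIndex → IsOpen[t₀] (H : Set M)) (h : @IsTfgProfinite M _ t) :
    t₀ ≤ t := by
  intro s hs
  exact @isOpen_of_forall_finiteIndex_mul_mem M _ t₀ h₀ hsc s
    (fun x hx => @exists_finiteIndex_mul_mem M _ t h s hs x hx)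

/-- **Comparison, second half and conclusion.**  If `t₀` is a topologically finitely generated profinite group
topology on `M` in which every finite-index subgroup is open, then every topologically finitely generated profinite
group topology `t` on `M` EQUALS `t₀`: by the first half the identity `(M, t₀) → (M, t)` is continuous, and a
continuous bijection from a compact space to a Hausdorff space is a homeomorphism (a `t₀`-open set has
`t₀`-compact, hence `t`-compact, hence `t`-closed complement). [cite: MochizukiFrdI2008, Def. 2.8(i) p.52] -/
theorem eq_of_forall_finiteIndex_isOpen {t₀ t : TopologicalSpace M} (h₀ : @IsTfgProfinite M _ t₀)
    (hsc : ∀ H : Subgroup M, H.FiniteIndex → IsOpen[t₀] (H : Set M)) (h : @IsTfgProfinite M _ t) :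
    t = t₀ := by
  have hle : t₀ ≤ t := le_of_forall_finiteIndex_isOpen h₀ hsc h
  refine le_antisymm ?_ hle
  intro s hs
  -- `sᶜ` is `t₀`-closed, hence `t₀`-compact, hence `t`-compact (the identity `t₀ → t` is continuous),
  -- hence `t`-closed (`t` is Hausdorff)
  haveI hc₀ : @CompactSpace M t₀ := @IsTfgProfinite.compactSpace M _ t₀ h₀
  haveI hT : @T2Space M t := @IsTfgProfinite.t2Space M _ t h
  have hK₀ : @IsCompact M t₀ sᶜ := @IsClosed.isCompact M t₀ sᶜ _ ((@isClosed_compl_iff M t₀ s).mpr hs)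
  have hK : @IsCompact M t sᶜ := by
    have himg := @IsCompact.image M M t₀ t sᶜ id hK₀ (@continuous_id_of_le M t₀ t hle)
    simpa only [Set.image_id] using himg
  exact (@isClosed_compl_iff M t s).mp (@IsCompact.isClosed M t _ sᶜ hK)

section OneTopology'

variable [TopologicalSpace M]

/-- On a FINITE group a topologically finitely generated profinite group topology is the discrete one (Hausdorff
+ finite). [cite: MochizukiFrdI2008, Def. 2.8(i) p.52] -/
theorem eq_bot_of_finite [Finite M] (h : IsTfgProfinite M) : ‹TopologicalSpace M› = ⊥ := by
  haveI := h.t2Space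
  exact (Finite.instDiscreteTopology (X := M)).eq_bot

/-- Under the named fact `Literature.GroupTheory.NikolovSegalStatement` (NOT proved in the tree), every
finite-index subgroup of a topologically finitely generated profinite group is open.
[cite: NikolovSegal2003, Thm 1.1] -/
theorem isOpen_of_finiteIndex_of_nikolovSegalStatement (h : IsTfgProfinite M)
    (hNS : Literature.GroupTheory.NikolovSegalStatement.{u}) (H : Subgroup M) (hH : H.FiniteIndex) :
    IsOpen (H : Set M) := by
  haveI := h.isTopologicalGroup
  haveI := h.compactSpace
  haveI := h.totallyDisconnectedSpace
  exact hNS M h.exists_finset_dense H hH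

end OneTopology'

end IsTfgProfinite

/-- **Def. 2.8 (i) "[uniquely determined]" — the bridge to strong completeness.**  If the group `M` carries ONE
topologically finitely generated profinite group topology in which every subgroup of finite index is open, then
any two topologically finitely generated profinite group topologies on `M` coincide.
[cite: MochizukiFrdI2008, Def. 2.8(i) p.52] -/
theorem TfgProfiniteTopologyUnique.of_forall_finiteIndex_isOpen (M : Type u) [Group M]
    [t₀ : TopologicalSpace M] (h₀ : IsTfgProfinite M)
    (hsc : ∀ H : Subgroup M, H.FiniteIndex → IsOpen (H : Set M)) : TfgProfiniteTopologyUnique M := by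
  intro t₁ t₂ h₁ h₂
  exact (IsTfgProfinite.eq_of_forall_finiteIndex_isOpen h₀ hsc h₁).trans
    (IsTfgProfinite.eq_of_forall_finiteIndex_isOpen h₀ hsc h₂).symm

/-- **Def. 2.8 (i) "[uniquely determined]" for FINITE groups (instance family).**  On a finite group any two
topologically finitely generated profinite group topologies coincide: a Hausdorff topology on a finite set is
discrete. [cite: MochizukiFrdI2008, Def. 2.8(i) p.52] -/
theorem TfgProfiniteTopologyUnique.of_finite (M : Type u) [Group M] [Finite M] :
    TfgProfiniteTopologyUnique M := by
  intro t₁ t₂ h₁ h₂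
  rw [@IsTfgProfinite.eq_bot_of_finite M _ t₁ _ h₁, @IsTfgProfinite.eq_bot_of_finite M _ t₂ _ h₂]

/-- **Def. 2.8 (i) "[uniquely determined]" for EVERY group, CONDITIONAL on Nikolov–Segal.**  Assuming the
named fact `Literature.GroupTheory.NikolovSegalStatement` ("in a topologically finitely generated profinite group
every finite-index subgroup is open" [cite: NikolovSegal2003, Thm 1.1] — recorded in the tree as a `Prop`, NOT
proved), any two topologically finitely generated profinite group topologies on any group coincide.  This is the
universal closure of the named statement of Def. 2.8 (i), conditionally.
[cite: MochizukiFrdI2008, Def. 2.8(i) p.52] -/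
theorem TfgProfiniteTopologyUnique.of_nikolovSegalStatement
    (hNS : Literature.GroupTheory.NikolovSegalStatement.{u}) (M : Type u) [Group M] :
    TfgProfiniteTopologyUnique M := by
  intro t₁ t₂ h₁ h₂
  exact (IsTfgProfinite.eq_of_forall_finiteIndex_isOpen h₁
    (@IsTfgProfinite.isOpen_of_finiteIndex_of_nikolovSegalStatement M _ t₁ h₁ hNS) h₂).symm

end General

end Literature.AlgebraicGeometry.Frobenioids
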